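/-
Copyright (c) 2026. All rights reserved.
Released under Apache 2.0 license as described in the file LICENSE.
Authors: abc-iut cell — seat abc-iut-w5-d058 (wave 5; §4(iii) non-vacuity programme, L4 rows of
abc-iut-w5-d056's KERNEL INHABITATION CENSUS v3: `GlobalAnabelianContext`, `AbsTopI.ConstructionDataClass`,
`TPairVocabulary`, `AugmentedProfiniteGrp`; riders `GaloisProSet`, `AutHolOrbispace`, `RelativeAnabelianDatum`).
-/
import Mathlib.Algebra.Module.PUnit
import Mathlib.Algebra.Field.ULift
import Literature.AnabelianGeometry.AbsoluteAnabelian.TPairs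
import Literature.AnabelianGeometry.AbsoluteAnabelian.AbsTopI.RelativeGC
import HarnessLib

/-!
# Non-vacuity records for the [AbsTopIII] §5 / [AbsTopI] §4 / [pGC]–[Tpcs] interface records of layer L4

S. Mochizuki, *Topics in absolute anabelian geometry III* [MochizukiAbsTopIII2015], Def 5.1 (i)–(iii), (v)
pp. 113–117 (global Galois-theaters, `T`-pairs); *Topics in absolute anabelian geometry I* [MochizukiAbsTopI2012],
Def 4.6 p. 55 (classes of construction data); *The local pro-p anabelian geometry of curves* [MochizukiLocAn1999],
Thm A p. 3 (`1 → Δ_X → Π_X → Γ_K → 1`).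

abc-iut-w5-d056's KERNEL INHABITATION CENSUS v3 (HOME/staging/w5/w5-d056/census/CENSUS-CELL-v3.md, 04:19Z) lists
the layer-L4 interface records `GlobalAnabelianContext` (202 consumer constants), `AbsTopI.ConstructionDataClass`
(118), `TPairVocabulary` (103), `AugmentedProfiniteGrp` (65), `AutHolOrbispace` (41) with ZERO kernel inhabitants:
every theorem quantified over them is, today, uninstantiated.  This PROOF-ONLY file (no `def` / `instance` /
`structure` / notation; witnesses built inside the theorem terms) records, with honest labels:

* `AugmentedProfiniteGrp.nonempty_point` — the POINT `Π = G ↠ G` (DEGENERATE: `Δ = 1`);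
  `AugmentedProfiniteGrp.exists_prod` — the SPLIT-PRODUCT MODEL `Π := Δ × G ↠ G` for EVERY profinite `Δ`, with
  `geom ≃* Δ` (a genuine extension of profinite groups with prescribed, possibly non-trivial, geometric part; honest
  label: split — the extensions `Π_X ↠ Γ_K` of hyperbolic curves are not asserted to be split);
  `AugmentedProfiniteGrp.homOver_point_eq` — over the point, a homomorphism over `G` IS the identity, so
  `OuterHom` is a singleton there (used below);
* `RelativeAnabelianDatum.exists_point` — the one-object datum over the point with `Hom = {id}`: its `RelIsomGC` and
  `RelHomGC` hold TAUTOLOGICALLY (label DEGENERATE: no hyperbolic curve has `Δ = 1`; a joint-satisfiability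
  witness of the two 'GC' conclusions, nothing about curves);
* `AbsTopI.ConstructionDataClass.nonempty_empty` / `exists_isChainFull_relIsomDGC_relHomDGC` — the EMPTY class
  (no base field) satisfies "chain-full ∧ rel-isom-DGC ∧ rel-hom-DGC" vacuously: the hypothesis package of
  [AbsTopI] Thm 4.7 / [AbsTopII] Cor 3.3 is jointly satisfiable (DEGENERATE);
  `AbsTopI.ConstructionDataClass.exists_point_rat` — ONE base field `ℚ`, one member object over the point
  extension `Π = G_ℚ`, no chain terms: chain-full, rel-isom-DGC and rel-hom-DGC hold (DEGENERATE, via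
  `homOver_point_eq`);
* `GaloisProSet.nonempty_point` — the one-point pro-set `{⊚}` (no local elements) over any topological group;
  `GaloisProSet.exists_valuationsGen` — the BASE-LEVEL MODEL `V⊚(F) = {⊚_F} ∪ V(F)^non ∪ V(F)^arc` of Def 5.1 (i)
  for a number field `F` (the file's real `ValuationsGen F`), discrete, with `Π` acting TRIVIALLY (honest label:
  this is the quotient `V⊚(F)` of the printed `V⊚(F̄/F)`, on which `Gal(F̄/F)` acts through the trivial group);
* `AutHolOrbispace.nonempty_complexPlane` — the L4 STUB record (carrier, `A_X`, `π₁^∧`; no axiom) at the complex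
  plane: carrier `ℂ`, `A_X := ℂ`, `π₁(ℂ)^∧ = 1` (consistent toy: `ℂ` is simply connected; not a hyperbolic
  orbicurve);
* `GlobalAnabelianContext.exists_degenerate` / `nonempty_degenerate` — the DEGENERATE context: `Ob(EA⊚) := ∅` (`IsAdmissible := ⊥`),
  `k_NF(Π) := ℚ` with the trivial `Π`-action, `V⊚(Π) := {⊚}`; every field law holds (vacuously where it
  quantifies over admissible `Π` or over archimedean `v`).  HONEST LABEL: in this instance every consumer binder
  `R.IsAdmissible E` is UNSATISFIABLE — the record's own laws are jointly consistent, nothing more; a genuine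
  context needs the étale `π₁` of hyperbolic orbicurves and [AbsTopIII] Thm 1.9 / Cor 2.8–2.9 (FOUNDATIONS row 12);
* `TPairVocabulary.nonempty_degenerate` — over EVERY context `R` and every `T`, the DEGENERATE vocabulary
  `T = T⊚ := Type u` (identity functor), all data `PUnit`, all predicates `⊤`, cyclotomes the trivial profinite
  group, no `Z`-indices.

HONEST FRAMING: consistency / packaging facts about the cell's own interface records; nothing of [AbsTopIII],
[AbsTopI], [pGC], [Tpcs] is asserted; instantiated ≠ endorsed; nothing here bears on the disputed [IUTchIII]
Cor. 3.12.
-/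

namespace Literature.AnabelianGeometry.AbsoluteAnabelian

open CategoryTheory Topology

universe u

/-! ### `AugmentedProfiniteGrp`: the point and the split product -/

namespace AugmentedProfiniteGrp

variable (G : ProfiniteGrp.{u})

/-- **The point** `Π = G ↠ G` inhabits `AugmentedProfiniteGrp G` (DEGENERATE: `Δ = 1`).
[cite: MochizukiLocAn1999, Thm A p.3] -/
theorem nonempty_point : Nonempty (AugmentedProfiniteGrp G) :=
  ⟨{ arith := G, aug := ContinuousMonoidHom.id G, aug_surjective := Function.surjective_id }⟩

/-- The point has trivial geometric part `Δ = 1`. [cite: MochizukiLocAn1999, Thm A p.3] -/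
theorem exists_geom_eq_bot : ∃ A : AugmentedProfiniteGrp G, A.geom = ⊥ :=
  ⟨{ arith := G, aug := ContinuousMonoidHom.id G, aug_surjective := Function.surjective_id },
    (MonoidHom.ker_eq_bot_iff _).mpr Function.injective_id⟩

/-- **Split-product model**: for every profinite `Δ`, the extension `Π := Δ × G ↠ G` (second projection)
inhabits `AugmentedProfiniteGrp G`, with arithmetic group `Δ × G` and geometric part `≃* Δ` (honest label:
SPLIT extension; nothing is asserted about the extensions of hyperbolic curves). [cite: MochizukiLocAn1999, Thm A p.3] -/
theorem exists_prod (D : ProfiniteGrp.{u}) :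
    ∃ A : AugmentedProfiniteGrp G, Nonempty (A.arith ≃ₜ* (D × G)) ∧ Nonempty (A.geom ≃* D) := by
  let A : AugmentedProfiniteGrp G :=
    { arith := ProfiniteGrp.of (D × G)
      aug := ContinuousMonoidHom.snd D G
      aug_surjective := fun g => ⟨(1, g), rfl⟩ }
  refine ⟨A, ⟨ContinuousMulEquiv.refl _⟩, ⟨?_⟩⟩
  exact
    { toFun := fun x => (x : D × G).1
      invFun := fun d => ⟨(d, 1), A.mem_geom.mpr rfl⟩
      left_inv := fun x => by
        obtain ⟨⟨d, g⟩, hx⟩ := x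
        have hg : g = 1 := A.mem_geom.mp hx
        subst hg
        rfl
      right_inv := fun _ => rfl
      map_mul' := fun _ _ => rfl }

variable {G}

/-- Over the POINT `Π = G ↠ G` (as target), a homomorphism over `G` is the identity: `aug_B ∘ φ = aug_A` with
`aug_B = id` pins `φ`. [cite: MochizukiLocAn1999, Thm A p.3] -/
theorem homOver_point_eq
    (φ ψ : HomOver ({ arith := G, aug := ContinuousMonoidHom.id G, aug_surjective := Function.surjective_id } :
      AugmentedProfiniteGrp G)
      ({ arith := G, aug := ContinuousMonoidHom.id G, aug_surjective := Function.surjective_id } :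
      AugmentedProfiniteGrp G)) : φ = ψ :=
  HomOver.ext fun x => (φ.over x).trans (ψ.over x).symm

/-- Hence over the point every outer homomorphism is the class of the identity.
[cite: MochizukiLocAn1999, Thm A p.3] -/
theorem outerHom_point_eq
    (c d : OuterHom ({ arith := G, aug := ContinuousMonoidHom.id G, aug_surjective := Function.surjective_id } :
      AugmentedProfiniteGrp G)
      ({ arith := G, aug := ContinuousMonoidHom.id G, aug_surjective := Function.surjective_id } :
      AugmentedProfiniteGrp G)) : c = d := by
  obtain ⟨φ, rfl⟩ := OuterHom.mk_surjective c
  obtain ⟨ψ, rfl⟩ := OuterHom.mk_surjective d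
  rw [homOver_point_eq φ ψ]

end AugmentedProfiniteGrp

/-! ### `RelativeAnabelianDatum`: the one-object datum over the point -/

namespace RelativeAnabelianDatum

variable (G : ProfiniteGrp.{u})

/-- **One-object datum over the point**: one object with `Π_X := G ↠ G`, `Hom = {id}` (declared an isomorphism
and a hyperbolic curve), `Σ := Set.univ`, `f ↦ [id]`.  Its `RelIsomGC` and `RelHomGC` hold TAUTOLOGICALLY
(`OuterHom` over the point is a singleton) — DEGENERATE joint-satisfiability witness of the two 'GC' conclusions,
nothing about curves. [cite: MochizukiLocAn1999, Thm A p.3] -/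
theorem exists_point : ∃ D : RelativeAnabelianDatum G,
    D.primes = Set.univ ∧ (∀ X, D.IsHyperbolicCurve X) ∧ D.RelIsomGC ∧ D.RelHomGC := by
  let A : AugmentedProfiniteGrp G :=
    { arith := G, aug := ContinuousMonoidHom.id G, aug_surjective := Function.surjective_id }
  let ι : A.HomOver A := ⟨ContinuousMonoidHom.id _, fun _ => rfl⟩
  refine ⟨{ Obj := PUnit.{u + 1}, Hom := fun _ _ => PUnit.{u + 1}, IsIso := fun _ => True,
            IsHyperbolicCurve := fun _ => True, primes := Set.univ, grp := fun _ => A,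
            outerHom := fun _ => AugmentedProfiniteGrp.OuterHom.mk ι }, rfl, fun _ => trivial, ?_, ?_⟩
  · intro X₁ X₂ _ _
    refine ⟨fun _ _ => ?_, fun _ _ _ _ _ => Subsingleton.elim _ _, fun c _ => ⟨PUnit.unit, trivial, ?_⟩⟩
    · show (AugmentedProfiniteGrp.OuterHom.mk ι).IsIso
      rw [AugmentedProfiniteGrp.OuterHom.isIso_mk]
      exact Function.bijective_id
    · exact AugmentedProfiniteGrp.outerHom_point_eq _ _
  · intro X Y _
    refine ⟨fun _ _ => ?_, fun _ _ _ _ _ => Subsingleton.elim _ _, fun c _ => ⟨PUnit.unit, trivial, ?_⟩⟩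
    · show (AugmentedProfiniteGrp.OuterHom.mk ι).IsOpen
      rw [AugmentedProfiniteGrp.OuterHom.isOpen_mk, AugmentedProfiniteGrp.HomOver.IsOpenHom]
      have : Set.range (ι.toHom) = Set.univ := Set.range_eq_univ.mpr Function.surjective_id
      rw [this]
      exact isOpen_univ
    · exact AugmentedProfiniteGrp.outerHom_point_eq _ _

end RelativeAnabelianDatum

/-! ### `AbsTopI.ConstructionDataClass`: the empty class and the one-field point class -/

namespace AbsTopI.ConstructionDataClass

/-- **The EMPTY class of construction data** (no base field) inhabits the record.
[cite: MochizukiAbsTopI2012, Def 4.6 (i) p.55] -/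
theorem nonempty_empty : Nonempty ConstructionDataClass.{u} :=
  ⟨{ Base := PEmpty.{u + 1}
     fld := fun b => b.elim
     instField := fun b => b.elim
     instCharZero := fun b => b.elim
     datum := fun b => b.elim
     Mem := fun b => b.elim
     IsHyperbolicOrbicurve := fun b => b.elim
     isHyperbolicOrbicurve_of_isHyperbolicCurve := fun b => b.elim
     chainTerms := fun b => b.elim }⟩

/-- The hypothesis package "chain-full ∧ rel-isom-DGC ∧ rel-hom-DGC" of [AbsTopI] Thm 4.7 / [AbsTopII] Cor 3.3 is
JOINTLY SATISFIABLE — vacuously, by the empty class (DEGENERATE). [cite: MochizukiAbsTopI2012, Def 4.6 (ii) p.56] -/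
theorem exists_isChainFull_relIsomDGC_relHomDGC :
    ∃ 𝒟 : ConstructionDataClass.{u}, 𝒟.IsChainFull ∧ 𝒟.RelIsomDGC ∧ 𝒟.RelHomDGC :=
  ⟨{ Base := PEmpty.{u + 1}
     fld := fun b => b.elim
     instField := fun b => b.elim
     instCharZero := fun b => b.elim
     datum := fun b => b.elim
     Mem := fun b => b.elim
     IsHyperbolicOrbicurve := fun b => b.elim
     isHyperbolicOrbicurve_of_isHyperbolicCurve := fun b => b.elim
     chainTerms := fun b => b.elim },
    fun b => b.elim, fun b => b.elim, fun b => b.elim⟩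

/-- **One-field point class**: ONE base field `ℚ`, the one-object datum over the point `Π = G_ℚ ↠ G_ℚ`
(`RelativeAnabelianDatum.exists_point`), every object a member and a hyperbolic orbicurve, NO chain terms:
chain-full, rel-isom-DGC and rel-hom-DGC all hold (DEGENERATE: `Δ = 1`; tautological 'GC').
[cite: MochizukiAbsTopI2012, Def 4.6 (i)(ii) pp.55–56] -/
theorem exists_point_rat :
    ∃ 𝒟 : ConstructionDataClass.{0}, Nonempty (𝒟.Base ≃ PUnit.{1}) ∧ (∀ b, Nonempty (𝒟.fld b ≃+* ℚ)) ∧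
      𝒟.IsChainFull ∧ 𝒟.RelIsomDGC ∧ 𝒟.RelHomDGC := by
  obtain ⟨D, -, hhyp, hIsom, hHom⟩ := RelativeAnabelianDatum.exists_point (absoluteGaloisGrp ℚ)
  refine ⟨{ Base := PUnit.{1}
            fld := fun _ => ℚ
            instField := fun _ => inferInstance
            instCharZero := fun _ => inferInstance
            datum := fun _ => D
            Mem := fun _ _ => True
            IsHyperbolicOrbicurve := fun _ _ => True
            isHyperbolicOrbicurve_of_isHyperbolicCurve := fun _ _ _ => trivial
            chainTerms := fun _ _ => ∅ }, ⟨Equiv.refl _⟩, fun _ => ⟨RingEquiv.refl _⟩, ?_, ?_, ?_⟩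
  · intro b X _ t ht
    exact ht.elim
  · intro b X₁ X₂ _ _
    exact hIsom X₁ X₂ (hhyp X₁) (hhyp X₂)
  · intro b X₁ X₂ _ _
    exact hHom X₁ X₂ (hhyp X₂)

end AbsTopI.ConstructionDataClass

/-! ### `GaloisProSet`: the one-point pro-set and the base-level model `V⊚(F)` -/

namespace GaloisProSet

/-- **The one-point pro-set `{⊚}`** (no local elements) over any topological group.
[cite: MochizukiAbsTopIII2015, Def 5.1 (i) p. 113] -/
theorem nonempty_point (P : Type u) [Group P] [TopologicalSpace P] : Nonempty (GaloisProSet P) :=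
  ⟨{ carrier := PUnit.{u + 1}
     continuousSMul := ⟨continuous_const (y := PUnit.unit)⟩
     generic := PUnit.unit
     non := ∅
     arc := ∅
     smul_generic := fun _ => rfl
     generic_notMem_non := fun h => h
     generic_notMem_arc := fun h => h
     disjoint_non_arc := disjoint_bot_left
     eq_generic_or_mem := fun _ => Or.inl rfl
     smul_mem_non := fun _ _ h => h.elim
     smul_mem_arc := fun _ _ h => h.elim }⟩

open NumberField IsDedekindDomain in
/-- **Base-level model `V⊚(F)`** of Def 5.1 (i): for a number field `F`, the real `ValuationsGen F =
{⊚_F} ∪ V(F)` (discrete), non-archimedean elements the finite places `HeightOneSpectrum (𝓞 F)`, archimedean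
elements the infinite places, with `Π` acting TRIVIALLY, satisfies every law of `GaloisProSet` (honest label: the
quotient `V⊚(F)` of the printed pro-set `V⊚(F̄/F)`). [cite: MochizukiAbsTopIII2015, Def 5.1 (i) p. 113] -/
theorem exists_valuationsGen (P : Type u) [Group P] [TopologicalSpace P] (F : Type u) [Field F] [NumberField F] :
    ∃ V : GaloisProSet P, ∃ e : V.carrier ≃ ValuationsGen F,
      e V.generic = ValuationsGen.generic ∧
      e '' V.non = Set.range (fun w : HeightOneSpectrum (𝓞 F) => (some (Sum.inr w) : ValuationsGen F)) ∧
      e '' V.arc = Set.range (fun w : InfinitePlace F => (some (Sum.inl w) : ValuationsGen F)) ∧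
      ∀ (g : P) (v : V.carrier), g • v = v := by
  letI : TopologicalSpace (ValuationsGen F) := ⊥
  haveI : DiscreteTopology (ValuationsGen F) := ⟨rfl⟩
  letI : MulAction P (ValuationsGen F) :=
    { smul := fun _ v => v
      one_smul := fun _ => rfl
      mul_smul := fun _ _ _ => rfl }
  haveI : ContinuousSMul P (ValuationsGen F) := ⟨continuous_snd⟩
  refine ⟨{ carrier := ValuationsGen F
            generic := ValuationsGen.generic
            non := Set.range (fun w : HeightOneSpectrum (𝓞 F) => (some (Sum.inr w) : ValuationsGen F))
            arc := Set.range (fun w : InfinitePlace F => (some (Sum.inl w) : ValuationsGen F))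
            smul_generic := fun _ => rfl
            generic_notMem_non := ?_
            generic_notMem_arc := ?_
            disjoint_non_arc := ?_
            eq_generic_or_mem := ?_
            smul_mem_non := fun _ _ h => h
            smul_mem_arc := fun _ _ h => h }, Equiv.refl _, rfl, ?_, ?_, fun _ _ => rfl⟩
  · rintro ⟨w, hw⟩
    exact Option.some_ne_none _ hw
  · rintro ⟨w, hw⟩
    exact Option.some_ne_none _ hw
  · refine Set.disjoint_left.mpr ?_
    rintro _ ⟨w, rfl⟩ ⟨w', hw'⟩
    exact Sum.inl_ne_inr (Option.some_injective _ hw')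
  · rintro (_ | v)
    · exact Or.inl rfl
    · rcases v with w | w
      · exact Or.inr (Or.inr ⟨w, rfl⟩)
      · exact Or.inr (Or.inl ⟨w, rfl⟩)
  · exact Set.image_id _
  · exact Set.image_id _

end GaloisProSet

/-! ### `AutHolOrbispace` (L4 stub record): the complex plane -/

/-- **The complex plane** inhabits the stub record `AutHolOrbispace` (carrier `ℂ`, `A_X := ℂ`, `π₁(ℂ)^∧ = 1`;
the record carries no axiom; consistent toy — `ℂ` is simply connected — not a hyperbolic orbicurve).
[cite: MochizukiAbsTopIII2015, Def 5.1 (ii) p. 114] -/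
theorem AutHolOrbispace.nonempty_complexPlane :
    ∃ X : AutHolOrbispace.{0}, X.carrier = ℂ ∧ X.fieldA = ℂ ∧ Subsingleton X.pi1Hat :=
  ⟨{ carrier := ℂ, fieldA := ℂ, pi1Hat := ProfiniteGrp.of PUnit.{1} }, rfl, rfl,
    inferInstanceAs (Subsingleton PUnit)⟩

/-! ### `GlobalAnabelianContext`: the degenerate context -/

/-- **The DEGENERATE global anabelian context**: `Ob(EA⊚) := ∅`, `k_NF(Π) := ℚ` (trivial `Π`-action),
`V⊚(Π) := {⊚}` (no local elements, so no `X(Π,v)`, `δ_{ell,v}`, `κ_{ell,v}` to give), `V⊚(f) := id`,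
`k_NF(f) := id`.  Every law of the record holds.  HONEST LABEL (the conclusion states it): every consumer
hypothesis `R.IsAdmissible E` is unsatisfiable in this instance; a genuine context = étale `π₁` + [AbsTopIII]
Thm 1.9 / Cor 2.8–2.9, not in the tree. [cite: MochizukiAbsTopIII2015, Def 5.1 (ii) p. 114] -/
theorem GlobalAnabelianContext.exists_degenerate :
    ∃ R : GlobalAnabelianContext.{u}, ∀ E, ¬ R.IsAdmissible E := by
  let V : ∀ E : FundamentalExtension.{u}, GaloisProSet E.arith := fun E =>
    { carrier := PUnit.{u + 1}
      continuousSMul := ⟨continuous_const (y := PUnit.unit)⟩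
      generic := PUnit.unit
      non := ∅
      arc := ∅
      smul_generic := fun _ => rfl
      generic_notMem_non := fun h => h
      generic_notMem_arc := fun h => h
      disjoint_non_arc := disjoint_bot_left
      eq_generic_or_mem := fun _ => Or.inl rfl
      smul_mem_non := fun _ _ h => h.elim
      smul_mem_arc := fun _ _ h => h.elim }
  exact
    ⟨{ IsAdmissible := fun _ => False
       isAdmissible_of_iso := fun _ h => h
       geom_isMax := fun _ h => h.elim
       kNF := fun _ => ULift.{u} ℚ
       instField := fun _ => inferInstance
       instAction := fun E => MulSemiringAction.compHom _ (1 : E.arith →* (ULift.{u} ℚ →+* ULift.{u} ℚ))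
       proVal := V
       archSpace := fun _ v => v.2.elim
       δell := fun _ v => v.2.elim
       κell := fun _ v => v.2.elim
       mapProVal := fun _ _ => Homeomorph.refl _
       mapProVal_smul := fun _ _ _ _ => rfl
       mapKNF := fun _ _ => RingEquiv.refl _ }, fun _ h => h⟩

/-- Hence `GlobalAnabelianContext` is inhabited (by the DEGENERATE context of `exists_degenerate`).
[cite: MochizukiAbsTopIII2015, Def 5.1 (ii) p. 114] -/
theorem GlobalAnabelianContext.nonempty_degenerate : Nonempty GlobalAnabelianContext.{u} :=
  let ⟨R, _⟩ := GlobalAnabelianContext.exists_degenerate.{u}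
  ⟨R⟩

/-! ### `TPairVocabulary`: the degenerate vocabulary over any context -/

/-- **The DEGENERATE `T`-pair vocabulary** over ANY context `R` and any `T`: `T = T⊚ := Type u` with the identity
functor, all continuity / MLF-Galois / Aut-holomorphic predicates `⊤`, Kummer structures `PUnit`, canonical data
`PUnit` with trivial actions and identity restriction morphisms, cyclotomes the trivial profinite group, cyclotome
compatibilities `⊤`, no `Z`-indices.  Joint-consistency of the record's fields, nothing more.
[cite: MochizukiAbsTopIII2015, Def 5.1 (v) pp. 116–117] -/
theorem TPairVocabulary.nonempty_degenerate (R : GlobalAnabelianContext.{u}) (T : TKind) :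
    Nonempty (TPairVocabulary R T) :=
  ⟨{ LocObj := Type u
     GlobObj := Type u
     toGlob := 𝟭 (Type u)
     IsContLoc := fun _ => True
     IsContGlob := fun _ => True
     IsMLFGaloisPair := fun _ => True
     KummerStr := fun _ _ => PUnit.{u + 1}
     IsAutHolPair := fun _ => True
     kummerTransport := fun _ _ _ => PUnit.unit
     kummerTransport_refl := fun _ => rfl
     globData := fun _ => PUnit.{u + 1}
     globAct := fun _ => 1
     locDataNon := fun _ _ => PUnit.{u + 1}
     locDataArc := fun _ _ => PUnit.{u + 1}
     locAct := fun _ _ => 1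
     locKummer := fun _ _ => PUnit.unit
     locRestrictNon := fun _ _ => 𝟙 _
     locRestrictArc := fun _ _ => 𝟙 _
     cyclotome := fun _ => ProfiniteGrp.of PUnit.{u + 1}
     cyclotomeGrp := fun _ => ProfiniteGrp.of PUnit.{u + 1}
     IsCyclotomeCompatible := fun _ _ => True
     IsCyclotomeArchCompatible := fun _ _ => True
     ZIndex := PEmpty.{u + 1}
     IsGeomIsoTo := fun z _ => z.elim }⟩

end Literature.AnabelianGeometry.AbsoluteAnabelian
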